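import Literature.NumberTheory.Automorphic.UnramifiedOrbitSetHermitian
import Literature.NumberTheory.Automorphic.CompactCoreCentralizerLevelOfIntegralConjugacy
import Literature.LinearAlgebra.Matrix.CentraliserOfSeparableCharpoly
import HarnessLib

/-!
# Kottwitz's orbit lemma and the compact core of the centraliser at a NON-RATIONAL reference: local elements with integral separable reduction,
# and adèles whose characteristic polynomial is `p ⊗ 1` for one separable `p ∈ E[X]`
(Kottwitz, *Stable trace formula: elliptic singular terms* (1986), Prop. 7.1 (local statement: `γ ∈ K` with `1 − α(γ)` a unit or `0` for every root)
and Cor. 7.3; Rogawski (1990), §3.3 p. 21, §4.3 p. 44, §5.4 p. 72)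

Topic `NumberTheory/Automorphic`; namespace `Literature.NumberTheory.Automorphic.UnitaryGroup`; THEOREMS ONLY (no definition, no instance, no named fact,
no `sorry`).  The ★ chain `UnramifiedOrbitSet{Split,Nonsplit,Local,Hermitian}` ∕ ★ `CompactCoreCentralizerLevelOfIntegralConjugacy` is stated at the
diagonal image of a RATIONAL `γ ∈ U(H)(L⁺)`.  The stable sides of the comparison sum over ADELIC classes (★ `MatchingAdele`, `MatchingAdeleG`,
`adelicStableClassesOver…`) which need not contain a rational point of the SAME form; what they carry is an integral component at almost every place and
ONE separable characteristic polynomial `p ∈ E[X]` (that of a rational element of ANOTHER form, ★ `Corresponds.charpoly_eq`).  This file re-runs the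
chain on that weaker datum — Kottwitz's hypotheses are LOCAL:

* §1 LOCAL, any `g ∈ U(J)(F_v)`: **`orbitSet_of_split_local`** ∕ **`orbitSet_of_nonsplit_local`** — if the one-place image of `g` (★ `localSplitEquiv` ∕ ★
  `localNonsplitEquiv`) is integral with an integral model of its characteristic polynomial separable modulo `𝔪_w` (and, at a non-split place, `v` is
  unramified in `E`), then `{y ∣ y g y⁻¹ ∈ U(J)(𝒪_v)} = U(J)(𝒪_v) · Z(g)` (★ F1 `mem_range_map_mul_centralizer_of_conj_mem_range` ∕ ★ F2
  `orbitSet_unitaryGroupOfForm_of_hnorm` + ★ `hnorm_of_isAdicComplete`); **`subgroup_le_glInt_of_isCompact_of_le_centralizer_local`** — compact subgroups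
  of `GL_N(E_w)` centralising an integral `γ_w` with separable characteristic polynomial and separable reduction are integral (Serre + F1, as in ★
  `subgroup_le_glInt_of_isCompact_of_le_centralizer`, the rational `γ ⊗ 1` replaced by any such `γ_w`).
* §2 ADELIC (generic `E/F`, `c`, `J` hermitian with `det J` a unit): for components `g v ∈ U(J)(F_v)` with `charpoly (g v) = p ⊗ 1` for ONE separable
  `p ∈ E[X]` and `g v ∈ U(J)(𝒪_v)` for almost every `v`: **`eventually_orbitSet_of_charpoly_eq`** and **`eventually_compactCore_centralizer_subset_of_charpoly_eq`**.
* §3 CM: for `g ∈ U(H)(𝔸_{L⁺})` (★ `cmDatum.Adelic`; integral a.e. by ★ `eventually_toLocal_mem_cmLocalIntegralLevel`) with `charpoly g_v = p ⊗ 1` at every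
  `v`: **`eventually_orbitSet_cmDatum_adelic`** and **`eventually_compactCore_centralizer_subset_cmDatum_adelic`** — the inputs of the unit factors
  `Φ_v(g_v, 1_{K_v}) = 1` (★ `orbitalIntegral_indicator_eq_of_orbitSet`) and of the canonical normalisation `(m v).atPoint g_v (π K_v) = 1` (★
  `IsCanonical.atPoint_image_mk_eq_one`) at EVERY matching adèle, with no rational base point.

## References
* R. E. Kottwitz, *Stable trace formula: elliptic singular terms*, Math. Ann. 275 (1986), §7, Prop. 7.1, Cor. 7.3 [Kottwitz1986].
* J. D. Rogawski, *Automorphic Representations of Unitary Groups in Three Variables*, Ann. of Math. Stud. 123 (1990), §3.3 p. 21, §4.3 p. 44, §5.4 p. 72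
  [Rogawski1990].
* J. Tits, *Reductive groups over local fields* (1979), §3.9 [Tits1979].
-/

set_option autoImplicit false

noncomputable section

open NumberField IsDedekindDomain Filter Polynomial
open scoped Matrix Pointwise

namespace Literature.NumberTheory.Automorphic

/-! ## §1a Compact subgroups centralising an integral local element with separable reduction -/

section LocalGL

variable {E : Type} [Field E] [NumberField E] (N : ℕ)

/-- **Compact subgroups of `GL_N(E_w)` centralising an integral regular semisimple `γ_w` are integral** — the LOCAL form of ★
`subgroup_le_glInt_of_isCompact_of_le_centralizer` (there `γ_w = γ ⊗ 1` for a rational `γ`): `γ_w ∈ GL_N(𝒪_w)` with separable characteristic polynomial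
(commutative centraliser, ★ `commute_of_commute_of_charpoly_separable`) and an integral model separable modulo `𝔪_w` (★ F1). [cite: Tits1979, §3.9]
[cite: Kottwitz1986, Prop. 7.1] -/
theorem subgroup_le_glInt_of_isCompact_of_le_centralizer_local (w : HeightOneSpectrum (𝓞 E)) (γw : GL (Fin N) (w.adicCompletion E))
    (hγint : γw ∈ glInt N (w.adicCompletion E))
    (hsepK : ((γw : Matrix (Fin N) (Fin N) (w.adicCompletion E)).charpoly).Separable)
    (hsep : ∃ q : (w.adicCompletionIntegers E)[X],
      q.map (w.adicCompletionIntegers E).subtype = (γw : Matrix (Fin N) (Fin N) (w.adicCompletion E)).charpoly ∧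
        (q.map (IsLocalRing.residue (w.adicCompletionIntegers E))).Separable)
    (C : Subgroup (GL (Fin N) (w.adicCompletion E))) (hC : IsCompact (C : Set (GL (Fin N) (w.adicCompletion E))))
    (hCZ : C ≤ Subgroup.centralizer ({γw} : Set (GL (Fin N) (w.adicCompletion E)))) :
    C ≤ glInt N (w.adicCompletion E) := by
  -- the centraliser of `γ_w` in `GL_N(E_w)` is commutative
  have hcommZ : ∀ a b : GL (Fin N) (w.adicCompletion E),
      a ∈ Subgroup.centralizer ({γw} : Set (GL (Fin N) (w.adicCompletion E))) →
      b ∈ Subgroup.centralizer ({γw} : Set (GL (Fin N) (w.adicCompletion E))) → a * b = b * a := by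
    intro a b ha hb
    rw [Subgroup.mem_centralizer_singleton_iff] at ha hb
    have ha' : Commute (a : Matrix (Fin N) (Fin N) (w.adicCompletion E)) (γw : Matrix (Fin N) (Fin N) (w.adicCompletion E)) := by
      have h := congrArg (fun u : GL (Fin N) (w.adicCompletion E) => (u : Matrix (Fin N) (Fin N) (w.adicCompletion E))) ha
      simp only [Units.val_mul] at h
      exact h
    have hb' : Commute (b : Matrix (Fin N) (Fin N) (w.adicCompletion E)) (γw : Matrix (Fin N) (Fin N) (w.adicCompletion E)) := by
      have h := congrArg (fun u : GL (Fin N) (w.adicCompletion E) => (u : Matrix (Fin N) (Fin N) (w.adicCompletion E))) hb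
      simp only [Units.val_mul] at h
      exact h
    exact Units.ext (Literature.LinearAlgebra.Matrix.commute_of_commute_of_charpoly_separable hsepK ha' hb').eq
  -- `K′ = GL_N(𝒪_w) ∩ Z(γ_w)`, compact
  haveI : CharZero (w.adicCompletion E) := charZero_of_injective_algebraMap (algebraMap E _).injective
  have hK'c : IsCompact ((glInt N (w.adicCompletion E) ⊓ Subgroup.centralizer ({γw} : Set (GL (Fin N) (w.adicCompletion E))) :
      Subgroup (GL (Fin N) (w.adicCompletion E))) : Set (GL (Fin N) (w.adicCompletion E))) := by
    rw [Subgroup.coe_inf]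
    exact (isCompact_glInt N (w.adicCompletion E)).inter_right (Set.isClosed_centralizer _)
  obtain ⟨D, hD⟩ := exists_subgroup_coe_eq_mul_of_forall_commute C
    (glInt N (w.adicCompletion E) ⊓ Subgroup.centralizer ({γw} : Set (GL (Fin N) (w.adicCompletion E))))
    (fun a ha b hb => hcommZ a b (hCZ ha) (Subgroup.mem_inf.1 hb).2)
  have hDc : IsCompact (D : Set (GL (Fin N) (w.adicCompletion E))) := by rw [hD]; exact hC.mul hK'c
  haveI : CompactSpace D := isCompact_iff_compactSpace.1 hDc
  -- Serre
  obtain ⟨P, hP⟩ := Literature.NumberTheory.GaloisRepresentations.exists_conj_mem_range_generalLinearGroup_map_of_valuationSubring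
    (O := w.adicCompletionIntegers E) (Valued.isOpen_valuationSubring (w.adicCompletion E))
    ({ D.subtype with continuous_toFun := continuous_subtype_val } : D →ₜ* GL (Fin N) (w.adicCompletion E))
  have hP' : ∀ d : GL (Fin N) (w.adicCompletion E), d ∈ D → P⁻¹ * d * P ∈ glInt N (w.adicCompletion E) := fun d hd =>
    (mem_range_map_adicCompletionIntegers_iff_mem_glInt N w _).1 (hP ⟨d, hd⟩)
  have hmemD : ∀ {d : GL (Fin N) (w.adicCompletion E)}, d ∈ (C : Set (GL (Fin N) (w.adicCompletion E))) *
      ((glInt N (w.adicCompletion E) ⊓ Subgroup.centralizer ({γw} : Set (GL (Fin N) (w.adicCompletion E))) :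
        Subgroup (GL (Fin N) (w.adicCompletion E))) : Set (GL (Fin N) (w.adicCompletion E))) → d ∈ D := fun hd => by
    rw [← SetLike.mem_coe, hD]; exact hd
  have hγD : γw ∈ D := hmemD ⟨1, C.one_mem, γw, Subgroup.mem_inf.2 ⟨hγint, Subgroup.mem_centralizer_singleton_iff.2 rfl⟩, one_mul _⟩
  -- the integral lift of `γ_w` and F1
  obtain ⟨γO, hγO⟩ := (mem_range_map_adicCompletionIntegers_iff_mem_glInt N w _).2 hγint
  obtain ⟨q, hq, hqsep⟩ := hsep
  have hchar : (γO : Matrix (Fin N) (Fin N) (w.adicCompletionIntegers E)).charpoly = q := by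
    apply Polynomial.map_injective (w.adicCompletionIntegers E).subtype Subtype.val_injective
    rw [hq, ← Matrix.charpoly_map]
    exact congrArg Matrix.charpoly (congrArg (fun u : GL (Fin N) (w.adicCompletion E) => (u : Matrix (Fin N) (Fin N) (w.adicCompletion E))) hγO)
  have hsep' : ((γO : Matrix (Fin N) (Fin N) (w.adicCompletionIntegers E)).charpoly.map
      (IsLocalRing.residue (w.adicCompletionIntegers E))).Separable := by rw [hchar]; exact hqsep
  have hconj : P⁻¹ * Matrix.GeneralLinearGroup.map (w.adicCompletionIntegers E).subtype γO * P⁻¹⁻¹ ∈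
      (Matrix.GeneralLinearGroup.map (n := Fin N) (w.adicCompletionIntegers E).subtype).range := by
    rw [inv_inv, hγO]
    exact (mem_range_map_adicCompletionIntegers_iff_mem_glInt N w _).2 (hP' γw hγD)
  obtain ⟨k, hk, z, hz, hkz⟩ := Set.mem_mul.1
    (Literature.LinearAlgebra.Matrix.mem_range_map_mul_centralizer_of_conj_mem_range (w.adicCompletionIntegers E).subtype
      Subtype.val_injective γO hsep' P⁻¹ hconj)
  rw [hγO] at hz
  intro c hc
  have hcZ : c ∈ Subgroup.centralizer ({γw} : Set (GL (Fin N) (w.adicCompletion E))) := hCZ hc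
  have h1 : P⁻¹ * c * P ∈ glInt N (w.adicCompletion E) := hP' c (hmemD ⟨c, hc, 1, Subgroup.one_mem _, mul_one c⟩)
  have hPeq : P = z⁻¹ * k⁻¹ := by rw [← mul_inv_rev, hkz, inv_inv]
  have h2 : P⁻¹ * c * P = k * c * k⁻¹ := by
    rw [← hkz, hPeq]
    calc k * z * c * (z⁻¹ * k⁻¹) = k * (z * c) * z⁻¹ * k⁻¹ := by simp only [mul_assoc]
      _ = k * (c * z) * z⁻¹ * k⁻¹ := by rw [hcommZ z c hz hcZ]
      _ = k * c * k⁻¹ := by rw [← mul_assoc k c z, mul_assoc (k * c) z z⁻¹, mul_inv_cancel, mul_one]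
  have hk' : k ∈ glInt N (w.adicCompletion E) := (mem_range_map_adicCompletionIntegers_iff_mem_glInt N w _).1 hk
  have h3 : c = k⁻¹ * (P⁻¹ * c * P) * k := by rw [h2]; group
  rw [h3]
  exact Subgroup.mul_mem _ (Subgroup.mul_mem _ (Subgroup.inv_mem _ hk') h1) hk'

end LocalGL

namespace UnitaryGroup

section Local

variable {F E : Type} [Field F] [NumberField F] [Field E] [NumberField E] [Algebra F E]
  (c : E ≃ₐ[F] E) (N : ℕ) (J : Matrix (Fin N) (Fin N) E)

variable [Algebra.IsQuadraticExtension F E] {v : HeightOneSpectrum (𝓞 F)}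

/-! ## §1b The orbit set at ANY local element: split and non-split places -/

/-- **Kottwitz's orbit lemma at a split place, at any local element**: `w ∣ v` split, `J_w ∈ GL_N(𝒪_w)`; for `g ∈ U(J)(F_v)` with `g_w ∈ GL_N(𝒪_w)`
(one-place image, ★ `localSplitEquiv`) and an integral model of the characteristic polynomial of `g_w` separable modulo `𝔪_w`:
`∀ y, y g y⁻¹ ∈ U(J)(𝒪_v) → y ∈ U(J)(𝒪_v) · Z(g)`. [cite: Kottwitz1986, Prop. 7.1] -/
theorem orbitSet_of_split_local (hc : c ≠ 1) (hJh : (J.map c)ᵀ = J) (w : PlacesOver E v) (hw : c • w.1 ≠ w.1) (hJw : IsUnit (placeForm J w.1))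
    (hJi : hJw.unit ∈ glInt N (w.1.adicCompletion E)) (g : «local» E c N J v)
    (hgint : localSplitEquiv c J hc hJh w hw hJw g ∈ glInt N (w.1.adicCompletion E))
    (hsep : ∃ q : (w.1.adicCompletionIntegers E)[X],
      q.map (w.1.adicCompletionIntegers E).subtype =
          ((localSplitEquiv c J hc hJh w hw hJw g : GL (Fin N) (w.1.adicCompletion E)) : Matrix (Fin N) (Fin N) (w.1.adicCompletion E)).charpoly ∧
        (q.map (IsLocalRing.residue (w.1.adicCompletionIntegers E))).Separable) :
    ∀ y : «local» E c N J v, y * g * y⁻¹ ∈ localIntegralLevel c N J v →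
      y ∈ (localIntegralLevel c N J v : Set («local» E c N J v)) * (Subgroup.centralizer ({g} : Set («local» E c N J v)) : Set («local» E c N J v)) := by
  obtain ⟨γO, hγO⟩ := (mem_range_map_adicCompletionIntegers_iff_mem_glInt N w.1 _).2 hgint
  obtain ⟨q, hq, hqsep⟩ := hsep
  have hchar : (γO : Matrix (Fin N) (Fin N) (w.1.adicCompletionIntegers E)).charpoly = q := by
    apply Polynomial.map_injective (w.1.adicCompletionIntegers E).subtype Subtype.val_injective
    rw [hq, ← Matrix.charpoly_map]
    exact congrArg Matrix.charpoly (congrArg (fun u : GL (Fin N) (w.1.adicCompletion E) => (u : Matrix (Fin N) (Fin N) (w.1.adicCompletion E))) hγO)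
  have hsep' : ((γO : Matrix (Fin N) (Fin N) (w.1.adicCompletionIntegers E)).charpoly.map
      (IsLocalRing.residue (w.1.adicCompletionIntegers E))).Separable := by rw [hchar]; exact hqsep
  have hGL := Literature.LinearAlgebra.Matrix.mem_range_map_mul_centralizer_of_conj_mem_range
    (w.1.adicCompletionIntegers E).subtype Subtype.val_injective γO hsep'
  have hKeq : ((Matrix.GeneralLinearGroup.map (n := Fin N) (w.1.adicCompletionIntegers E).subtype).range :
        Set (GL (Fin N) (w.1.adicCompletion E))) = (glInt N (w.1.adicCompletion E) : Set (GL (Fin N) (w.1.adicCompletion E))) :=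
    Set.ext fun g' => mem_range_map_adicCompletionIntegers_iff_mem_glInt N w.1 g'
  refine orbitSet_of_mulEquiv (localSplitEquiv c J hc hJh w hw hJw).toMulEquiv (localIntegralLevel c N J v)
    (glInt N (w.1.adicCompletion E)) (fun g' => mem_localIntegralLevel_iff_of_ne c N J hc hJh w hw hJw hJi g') g fun y' hy' => ?_
  have he : (localSplitEquiv c J hc hJh w hw hJw).toMulEquiv g = Matrix.GeneralLinearGroup.map (w.1.adicCompletionIntegers E).subtype γO := hγO.symm
  rw [he] at hy' ⊢
  rw [← hKeq]
  exact hGL y' ((mem_range_map_adicCompletionIntegers_iff_mem_glInt N w.1 _).2 hy')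

/-- **Kottwitz's orbit lemma at an unramified non-split place, at any local element**: `w ∣ v` with `c • w = w`, `v` unramified in `E`,
`J_w ∈ GL_N(𝒪_w)`; for `g ∈ U(J)(F_v)` with `g_w ∈ GL_N(𝒪_w)` (★ `localNonsplitEquiv`) and an integral model of its characteristic polynomial separable
modulo `𝔪_w`: `∀ y, y g y⁻¹ ∈ U(J)(𝒪_v) → y ∈ U(J)(𝒪_v) · Z(g)` — ★ `orbitSet_of_nonsplit` + ★ `orbitSet_unitaryGroupOfForm_of_hnorm` with the norm equation
solved by ★ `hnorm_of_isAdicComplete` (the unit `σO a − a` from ★ `exists_isUnit_map_sub_of_isUnramifiedIn`). [cite: Kottwitz1986, Prop. 7.1] -/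
theorem orbitSet_of_nonsplit_local (hc : c ≠ 1) (hJh : (J.map c)ᵀ = J) (w : PlacesOver E v) (hw : c • w.1 = w.1)
    (hv : Algebra.IsUnramifiedIn (𝓞 E) v.asIdeal) (hJw : IsUnit (placeForm J w.1)) (hJi : hJw.unit ∈ glInt N (w.1.adicCompletion E))
    (g : «local» E c N J v)
    (hgint : ((localNonsplitEquiv c J hc w hw g : unitaryGroupOfForm (galAdicCompletionMap (L := E) c hw) (placeForm J w.1)) :
      GL (Fin N) (w.1.adicCompletion E)) ∈ glInt N (w.1.adicCompletion E))
    (hsep : ∃ q : (w.1.adicCompletionIntegers E)[X],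
      q.map (w.1.adicCompletionIntegers E).subtype =
          (((localNonsplitEquiv c J hc w hw g : unitaryGroupOfForm (galAdicCompletionMap (L := E) c hw) (placeForm J w.1)) :
            GL (Fin N) (w.1.adicCompletion E)) : Matrix (Fin N) (Fin N) (w.1.adicCompletion E)).charpoly ∧
        (q.map (IsLocalRing.residue (w.1.adicCompletionIntegers E))).Separable) :
    ∀ y : «local» E c N J v, y * g * y⁻¹ ∈ localIntegralLevel c N J v →
      y ∈ (localIntegralLevel c N J v : Set («local» E c N J v)) * (Subgroup.centralizer ({g} : Set («local» E c N J v)) : Set («local» E c N J v)) := by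
  refine orbitSet_of_nonsplit c N J hc w hw g
    (orbitSet_unitaryGroupOfForm_of_hnorm c N J hc hJh w hw hJw hJi (fun σO hσO Jt _ hJt hJtdet γt hγtU hsep' => ?_) _ hgint hsep)
  obtain ⟨a, ha⟩ := exists_isUnit_map_sub_of_isUnramifiedIn c w hc hw hv σO hσO
  exact Literature.LinearAlgebra.Matrix.hnorm_of_isAdicComplete σO (map_map_eq_self_of_restrict c w hc hw σO hσO) ha hJt hJtdet hγtU hsep'

end Local

/-! ## §2 Adelic components with one separable characteristic polynomial `p ⊗ 1` -/

section Adelic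

variable {F E : Type} [Field F] [NumberField F] [Field E] [NumberField E] [Algebra F E]
  (c : E ≃ₐ[F] E) (N : ℕ) (J : Matrix (Fin N) (Fin N) E)

variable [Algebra.IsQuadraticExtension F E]

/-- The matrix of the one-place image `localNonsplitEquiv g` is the `w`-component of the matrix of `g` (definitional; ★ `coe_localPiNonsplitEquiv_apply`).
[cite: PlatonovRapinchuk1994, §5.1] -/
theorem coe_coe_localNonsplitEquiv_apply {v : HeightOneSpectrum (𝓞 F)} (hc : c ≠ 1) (w : PlacesOver E v) (hw : c • w.1 = w.1) (g : «local» E c N J v) :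
    (((localNonsplitEquiv c J hc w hw g : unitaryGroupOfForm (galAdicCompletionMap (L := E) c hw) (placeForm J w.1)) :
        GL (Fin N) (w.1.adicCompletion E)) : Matrix (Fin N) (Fin N) (w.1.adicCompletion E)) =
      ((g : GL (Fin N) (LocalRing E v)) : Matrix (Fin N) (Fin N) (LocalRing E v)).map
        (Pi.evalRingHom (fun w' : PlacesOver E v => w'.1.adicCompletion E) w) :=
  rfl

omit [NumberField F] [Algebra.IsQuadraticExtension F E] in
/-- The characteristic polynomial of the `w`-component of `g ∈ GL_N(∏_{w′ ∣ v} E_{w′})` is the `w`-component of `charpoly g`; with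
`charpoly g = p ⊗ 1` it is `p` read in `E_w[X]`. [cite: PlatonovRapinchuk1994, §5.1] -/
theorem charpoly_map_evalRingHom_eq_of_charpoly_eq {v : HeightOneSpectrum (𝓞 F)} (w : PlacesOver E v) (p : E[X]) (g : GL (Fin N) (LocalRing E v))
    (hchar : (g : Matrix (Fin N) (Fin N) (LocalRing E v)).charpoly = p.map (algebraMap E (LocalRing E v))) :
    ((g : Matrix (Fin N) (Fin N) (LocalRing E v)).map (Pi.evalRingHom (fun w' : PlacesOver E v => w'.1.adicCompletion E) w)).charpoly =
      p.map (algebraMap E (w.1.adicCompletion E)) := by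
  rw [Matrix.charpoly_map, hchar, Polynomial.map_map]
  rfl

omit [Algebra.IsQuadraticExtension F E] in
/-- Only finitely many places of `F` ramify in `E` (private copy of ★ B9's lemma). [cite: PlatonovRapinchuk1994, §5.1] -/
private theorem finite_setOf_not_isUnramifiedIn' :
    {v : HeightOneSpectrum (𝓞 F) | ¬ Algebra.IsUnramifiedIn (𝓞 E) v.asIdeal}.Finite := by
  have hD : differentIdeal (𝓞 F) (𝓞 E) ≠ ⊥ := differentIdeal_ne_bot
  have hfin : {Q : HeightOneSpectrum (𝓞 E) | Q.asIdeal ∣ differentIdeal (𝓞 F) (𝓞 E)}.Finite :=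
    Ideal.finite_factors hD
  refine (hfin.image fun Q => Q.under (𝓞 F)).subset ?_
  intro q hq
  simp only [Set.mem_setOf_eq, Algebra.IsUnramifiedIn, not_forall] at hq
  obtain ⟨Q, hQprime, hQover, hQunr⟩ := hq
  haveI := hQprime
  have hQne : Q ≠ ⊥ := Ideal.ne_bot_of_liesOver_of_ne_bot q.ne_bot Q
  refine ⟨⟨Q, hQprime, hQne⟩, ?_, ?_⟩
  · exact dvd_differentIdeal_iff.mpr hQunr
  · exact HeightOneSpectrum.ext hQover.over.symm

/-- **The orbit set at almost every place, for components with one separable characteristic polynomial.**  For `c ≠ 1`, `J` `c`-hermitian with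
`det J` a unit, `p ∈ E[X]` SEPARABLE, and components `g v ∈ U(J)(F_v)` with `charpoly (g v) = p ⊗ 1` for every `v` and `g v ∈ U(J)(𝒪_v)` for almost every `v`:
`∀ᶠ v, ∀ y ∈ U(J)(F_v), y (g v) y⁻¹ ∈ U(J)(𝒪_v) → y ∈ U(J)(𝒪_v) · Z(g v)` — the exceptional places: ramified in `E`, `J_w ∉ GL_N(𝒪_w)`, `g v ∉ U(J)(𝒪_v)`, no
separable integral model of `p` (★ `eventually_exists_separable_lift`). [cite: Kottwitz1986, Prop. 7.1; Cor. 7.3] [cite: Rogawski1990, §4.3 p. 44] -/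
theorem eventually_orbitSet_of_charpoly_eq (hc : c ≠ 1) (hJh : (J.map c)ᵀ = J) (hJ : IsUnit J.det) (p : E[X]) (hp : p.Separable)
    (g : ∀ v : HeightOneSpectrum (𝓞 F), «local» E c N J v)
    (hchar : ∀ v : HeightOneSpectrum (𝓞 F),
      Matrix.charpoly (Units.val (g v : GL (Fin N) (LocalRing E v))) = p.map (algebraMap E (LocalRing E v)))
    (hgint : ∀ᶠ v : HeightOneSpectrum (𝓞 F) in cofinite, g v ∈ localIntegralLevel c N J v) :
    ∀ᶠ v : HeightOneSpectrum (𝓞 F) in cofinite,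
      ∀ y : «local» E c N J v, y * g v * y⁻¹ ∈ localIntegralLevel c N J v →
        y ∈ (localIntegralLevel c N J v : Set («local» E c N J v)) *
          (Subgroup.centralizer ({g v} : Set («local» E c N J v)) : Set («local» E c N J v)) := by
  have hJu : IsUnit J := (Matrix.isUnit_iff_isUnit_det J).2 hJ
  filter_upwards [eventually_forall_unit_placeForm_mem_glInt (F := F) N J hJu, hgint,
    eventually_forall_placesOver E (eventually_exists_separable_lift p hp),
    (finite_setOf_not_isUnramifiedIn' (F := F) (E := E)).compl_mem_cofinite] with v hint hgv hsep hunr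
  have hv : Algebra.IsUnramifiedIn (𝓞 E) v.asIdeal := not_not.1 hunr
  obtain ⟨w⟩ := (inferInstance : Nonempty (PlacesOver E v))
  obtain ⟨q, hq, hqsep⟩ := hsep w
  have hcharw := charpoly_map_evalRingHom_eq_of_charpoly_eq (E := E) N w p (g v : GL (Fin N) (LocalRing E v)) (hchar v)
  by_cases hw : c • w.1 = w.1
  · refine orbitSet_of_nonsplit_local c N J hc hJh w hw hv (isUnit_placeForm J hJu w.1) (hint w) (g v)
      ((mem_localIntegralLevel_iff_of_smul_eq c N J hc w hw (g v)).1 hgv) ⟨q, ?_, hqsep.map⟩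
    rw [coe_coe_localNonsplitEquiv_apply, hcharw]; exact hq
  · refine orbitSet_of_split_local c N J hc hJh w hw (isUnit_placeForm J hJu w.1) (hint w) (g v)
      ((mem_localIntegralLevel_iff_of_ne c N J hc hJh w hw (isUnit_placeForm J hJu w.1) (hint w) (g v)).1 hgv) ⟨q, ?_, hqsep.map⟩
    rw [coe_localSplitEquiv_apply, hcharw]; exact hq

/-- **The compact core of the centraliser at almost every place, for components with one separable characteristic polynomial**: same hypotheses,
`∀ᶠ v, compactCore Z(g v) ⊆ U(J)(𝒪_v)` (★ `compactCore_centralizer_subset_of_hom` + §1a at the one-place image). [cite: Tits1979, §3.9]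
[cite: Rogawski1990, §4.3 p. 43] -/
theorem eventually_compactCore_centralizer_subset_of_charpoly_eq (hc : c ≠ 1) (hJh : (J.map c)ᵀ = J) (hJ : IsUnit J.det) (p : E[X])
    (hp : p.Separable) (g : ∀ v : HeightOneSpectrum (𝓞 F), «local» E c N J v)
    (hchar : ∀ v : HeightOneSpectrum (𝓞 F),
      Matrix.charpoly (Units.val (g v : GL (Fin N) (LocalRing E v))) = p.map (algebraMap E (LocalRing E v)))
    (hgint : ∀ᶠ v : HeightOneSpectrum (𝓞 F) in cofinite, g v ∈ localIntegralLevel c N J v) :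
    ∀ᶠ v : HeightOneSpectrum (𝓞 F) in cofinite,
      compactCore (Subgroup.centralizer ({g v} : Set («local» E c N J v))) ⊆ Subtype.val ⁻¹' (localIntegralLevel c N J v : Set («local» E c N J v)) := by
  have hJu : IsUnit J := (Matrix.isUnit_iff_isUnit_det J).2 hJ
  filter_upwards [eventually_forall_unit_placeForm_mem_glInt (F := F) N J hJu, hgint,
    eventually_forall_placesOver E (eventually_exists_separable_lift p hp)] with v hint hgv hsep
  obtain ⟨w⟩ := (inferInstance : Nonempty (PlacesOver E v))
  obtain ⟨q, hq, hqsep⟩ := hsep w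
  have hcharw := charpoly_map_evalRingHom_eq_of_charpoly_eq (E := E) N w p (g v : GL (Fin N) (LocalRing E v)) (hchar v)
  by_cases hw : c • w.1 = w.1
  · have hq' : q.map (w.1.adicCompletionIntegers E).subtype =
        (((localNonsplitEquiv c J hc w hw (g v) : unitaryGroupOfForm (galAdicCompletionMap (L := E) c hw) (placeForm J w.1)) :
          GL (Fin N) (w.1.adicCompletion E)) : Matrix (Fin N) (Fin N) (w.1.adicCompletion E)).charpoly := by
      rw [coe_coe_localNonsplitEquiv_apply, hcharw]; exact hq
    have hsepK : ((((localNonsplitEquiv c J hc w hw (g v) : unitaryGroupOfForm (galAdicCompletionMap (L := E) c hw) (placeForm J w.1)) :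
          GL (Fin N) (w.1.adicCompletion E)) : Matrix (Fin N) (Fin N) (w.1.adicCompletion E)).charpoly).Separable := by
      rw [coe_coe_localNonsplitEquiv_apply, hcharw]; exact hp.map
    exact compactCore_centralizer_subset_of_hom N w.1
      ((unitaryGroupOfForm (galAdicCompletionMap (L := E) c hw) (placeForm J w.1)).subtype.comp
        (localNonsplitEquiv c J hc w hw).toMulEquiv.toMonoidHom)
      (continuous_subtype_val.comp (localNonsplitEquiv c J hc w hw).continuous) (localIntegralLevel c N J v)
      (fun g' => mem_localIntegralLevel_iff_of_smul_eq c N J hc w hw g') (g v) _ rfl fun C hC hCZ =>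
      subgroup_le_glInt_of_isCompact_of_le_centralizer_local N w.1 _ ((mem_localIntegralLevel_iff_of_smul_eq c N J hc w hw (g v)).1 hgv)
        hsepK ⟨q, hq', hqsep.map⟩ C hC hCZ
  · have hq' : q.map (w.1.adicCompletionIntegers E).subtype =
        ((localSplitEquiv c J hc hJh w hw (isUnit_placeForm J hJu w.1) (g v) : GL (Fin N) (w.1.adicCompletion E)) :
          Matrix (Fin N) (Fin N) (w.1.adicCompletion E)).charpoly := by
      rw [coe_localSplitEquiv_apply, hcharw]; exact hq
    have hsepK : (((localSplitEquiv c J hc hJh w hw (isUnit_placeForm J hJu w.1) (g v) : GL (Fin N) (w.1.adicCompletion E)) :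
          Matrix (Fin N) (Fin N) (w.1.adicCompletion E)).charpoly).Separable := by
      rw [coe_localSplitEquiv_apply, hcharw]; exact hp.map
    exact compactCore_centralizer_subset_of_hom N w.1 (localSplitEquiv c J hc hJh w hw (isUnit_placeForm J hJu w.1)).toMulEquiv.toMonoidHom
      (localSplitEquiv c J hc hJh w hw (isUnit_placeForm J hJu w.1)).continuous (localIntegralLevel c N J v)
      (fun g' => mem_localIntegralLevel_iff_of_ne c N J hc hJh w hw (isUnit_placeForm J hJu w.1) (hint w) g') (g v) _ rfl fun C hC hCZ =>
      subgroup_le_glInt_of_isCompact_of_le_centralizer_local N w.1 _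
        ((mem_localIntegralLevel_iff_of_ne c N J hc hJh w hw (isUnit_placeForm J hJu w.1) (hint w) (g v)).1 hgv) hsepK ⟨q, hq', hqsep.map⟩ C hC hCZ

end Adelic

/-! ## §3 The CM dress: adèles of `U(H)` with one separable characteristic polynomial -/

section CM

variable (L : Type) [Field L] [NumberField L] [IsCMField L] (N : ℕ) (H : Matrix (Fin N) (Fin N) L)

/-- **Kottwitz's orbit lemma at the components of an adèle `g ∈ U(H)(𝔸_{L⁺})` whose characteristic polynomial is `p ⊗ 1`, `p ∈ L[X]` separable**
(no rationality of `g`: the shape of a matching adèle over a rational element of another form): for `H` hermitian with `det H ≠ 0`,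
`∀ᶠ v, ∀ y ∈ U(H)(L⁺_v), y g_v y⁻¹ ∈ K_v → y ∈ K_v · Z(g_v)` (`g_v ∈ K_v` a.e. by ★ `eventually_toLocal_mem_cmLocalIntegralLevel`).
[cite: Kottwitz1986, Prop. 7.1; Cor. 7.3] [cite: Rogawski1990, §4.3 p. 44; §5.4 p. 72] -/
theorem eventually_orbitSet_cmDatum_adelic (hH : (H.map (cmConjRingHom L))ᵀ = H) (hHd : H.det ≠ 0) (p : L[X]) (hp : p.Separable)
    (g : (cmDatum L N H).Adelic)
    (hchar : ∀ v : HeightOneSpectrum (𝓞 ↥(maximalRealSubfield L)),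
      Matrix.charpoly (Units.val (((cmDatum L N H).toLocal v g).val : GL (Fin N) (LocalRing L v))) = p.map (algebraMap L (LocalRing L v))) :
    ∀ᶠ v : HeightOneSpectrum (𝓞 ↥(maximalRealSubfield L)) in cofinite,
      ∀ y : (cmDatum L N H).Local v, y * (cmDatum L N H).toLocal v g * y⁻¹ ∈ cmLocalIntegralLevel L N H v →
        y ∈ (cmLocalIntegralLevel L N H v : Set ((cmDatum L N H).Local v)) *
          (Subgroup.centralizer ({(cmDatum L N H).toLocal v g} : Set ((cmDatum L N H).Local v)) : Set ((cmDatum L N H).Local v)) :=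
  eventually_orbitSet_of_charpoly_eq (IsCMField.complexConj L) N H (IsCMField.complexConj_ne_one L) hH (isUnit_iff_ne_zero.2 hHd) p hp
    (fun v => (cmDatum L N H).toLocal v g) hchar (Rogawski1990.eventually_toLocal_mem_cmLocalIntegralLevel g)

/-- **The compact core of the centraliser of the components of such an adèle lies in the level a.e.**: `∀ᶠ v, compactCore Z(g_v) ⊆ K_v` — the input of
the canonical normalisation `(m v).atPoint g_v (π K_v) = 1` (★ `IsCanonical.atPoint_image_mk_eq_one`) at every matching adèle.
[cite: Tits1979, §3.9] [cite: Rogawski1990, §4.3 p. 43] -/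
theorem eventually_compactCore_centralizer_subset_cmDatum_adelic (hH : (H.map (cmConjRingHom L))ᵀ = H) (hHd : H.det ≠ 0) (p : L[X])
    (hp : p.Separable) (g : (cmDatum L N H).Adelic)
    (hchar : ∀ v : HeightOneSpectrum (𝓞 ↥(maximalRealSubfield L)),
      Matrix.charpoly (Units.val (((cmDatum L N H).toLocal v g).val : GL (Fin N) (LocalRing L v))) = p.map (algebraMap L (LocalRing L v))) :
    ∀ᶠ v : HeightOneSpectrum (𝓞 ↥(maximalRealSubfield L)) in cofinite,
      compactCore (Subgroup.centralizer ({(cmDatum L N H).toLocal v g} : Set ((cmDatum L N H).Local v))) ⊆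
        Subtype.val ⁻¹' (cmLocalIntegralLevel L N H v : Set ((cmDatum L N H).Local v)) :=
  eventually_compactCore_centralizer_subset_of_charpoly_eq (IsCMField.complexConj L) N H (IsCMField.complexConj_ne_one L) hH
    (isUnit_iff_ne_zero.2 hHd) p hp (fun v => (cmDatum L N H).toLocal v g) hchar (Rogawski1990.eventually_toLocal_mem_cmLocalIntegralLevel g)

end CM

end UnitaryGroup

end Literature.NumberTheory.Automorphic

end
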